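import Mathlib.Tactic
import Mathlib.Algebra.Order.Floor.Defs
import HarnessLib
import Summits.CriticalPhenomena.PercolationContinuityZ3.Theorems.PercNearOneGluingNoHeavyLowerTailQuantitativeAntitheticTowerChain

/-!
# (DC+) at the end of a hub–path arm attached to an ARBITRARY core: the virtual-side dictionary (PROOFS §P72 (f); BENCH M2-R114)

Support file (`--supports stmt-CriticalPhenomena-4575`), prover seat `prim-rate-mine-2` (lane prim-rate, constants-miner (c);
`run/shared/lean/prim/prim-rate/prim-rate-mine-2/PROOFS.md` §P72 (f)).  No definitions, no named facts, no sorries; standard axioms.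

SETTING.  A ONE-ARM graph `G_k`: an arbitrary core `Q` (containing the hub's neighbours, the observer `a` and the terminal `u`) plus a hub–path
arm `b = v₁ – … – v_k – c` of length `k` attached at an arbitrary core vertex `c`, every `v_i` joined to the hub `x`.  This class is genuinely
4-terminal (the core meets `x`, `a`, `u` and, through `c`, the arm of `b`).  By the ARM LEMMA (PROOFS §P70 (q), §P71 (d)) the antithetic integers are
affine in `k`: `C₀(G_k) = a₀ + β k`, `S(G_k) = s₀ + σ k`; at the arm's end pair `e = v₁v₂` one has `Φ(G_k − e) = 0` and `G_k/e ≅ G_{k−1}`, so the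
(DC+) margin is `2·[β + σ·C(n) + Δ·(s₀ + σ(k−1))]`, `n = k + n_Q + 1`, `Δ = C(n) − C(n−1)`.  PROOFS §P72 (f) identifies the slopes with COUNTS OF
THE CORE ALONE: `σ = λ̌(Q*; x, c, u)` (the core read as a side graph with apex `c` and terminal `u`), `s₀ = φ̌(Q*;x,c,u) + ν(Q*;x,c,u)`, `β = A⁻ − A⁺`
(the arm-end counts of PROOFS §P71 (e″) collapsed onto the core), and conjectures two CORE SIZE LEMMAS (census-exact for all 1 908 cores with
`n_Q ≤ 4`, kit census `n_Q = 5, 6`): (CSL′) `−β ≤ (κ_c − 1)·σ` with `κ_c = |component of u in Q − c|` — for `c = a` this is the one-side lemma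
(aK4b′) —, and (CS1) `β < 0 ⇒ s₀ ≥ σ − β`.  With the VIRTUAL SIDE COUNTS `λ* := σ`, `φ* := σ − β`, `ν* := s₀ + β − σ` the margin takes EXACTLY the
form of PROOFS §P71 (h)(ii) (`CSH.dcplus_armSide_margin_nonneg`), so:

* `CSH.dcplus_oneArm_margin_nonneg` — if `−β ≤ (κ−1)σ`, `s₀ + β ≥ σ`, `σ ≥ 0`, `κ ≤ n_Q − 1` and the arm is long, `k ≥ κ + 1` (`K = k + n_Q − 1 ≥ 5`),
  then `β + σ·c K + Δ·(s₀ + σ(k−1)) ≥ 0`: (DC+) holds at the arm's end pair — the 4-terminal generalisation of the tower chain (`c = a`, core = the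
  other arm: `κ = k_R`, condition `k_L ≥ k_R + 1`; the balanced case is `CSH.towerChain_step_eq_zero`).
* `CSH.dcplus_oneArm_margin_nonneg_of_beta_nonneg` — if `β ≥ 0` the margin is trivially `≥ 0` (`s₀, σ ≥ 0`, `c K ≥ 0`, `Δ ≥ 0`).
[cite: VandenbergHaggstromKahn2005, Thm. 1.3 (p. 6)] [cite: Harris1960, Lemma 4.1 (p. 16)]
-/

namespace Summit.CriticalPhenomena.PercolationContinuityZ3.Theorems.CSH

/-- **(DC+) at the end of a long arm against an arbitrary core** (PROOFS §P72 (f)), from the two core size lemmas as hypotheses: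
with `K = k + r ≥ 5` (`r = n_Q − 1`), `c = c K = ⌊K²/4⌋/K − 1`, `Δ = c K − c (K−1)`, slopes `β, σ` and intercept `s₀` of the arm lemma satisfying
`σ ≥ 0`, (CSL′) `−β ≤ (κ − 1)σ`, (CS1) `σ − β ≤ s₀`, `κ ≤ r`, and `k ≥ κ + 1`:  `0 ≤ β + σ·c + Δ·(s₀ + σ·(k − 1))`.
Proof: `CSH.dcplus_armSide_margin_nonneg` applied to the virtual side counts `(λ, φ, ν) := (σ, σ − β, s₀ + β − σ)`. [cite: VandenbergHaggstromKahn2005, Thm. 1.3 (p. 6)] -/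
theorem dcplus_oneArm_margin_nonneg (K k r κ : ℕ) (hK : 5 ≤ K) (hsum : k + r = K) (hκr : κ ≤ r) (hkκ : κ + 1 ≤ k)
    (β σ s₀ : ℚ) (hσ : 0 ≤ σ) (hCSL : -β ≤ (κ - 1 : ℚ) * σ) (hCS1 : σ - β ≤ s₀) :
    0 ≤ β + σ * ((((K ^ 2 / 4 : ℕ) : ℚ) / K - 1))
        + ((((K ^ 2 / 4 : ℕ) : ℚ) / K - 1) - ((((K - 1) ^ 2 / 4 : ℕ) : ℚ) / ((K - 1 : ℕ) : ℚ) - 1)) * (s₀ + σ * ((k : ℚ) - 1)) := by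
  have h := dcplus_armSide_margin_nonneg K k r κ hK hsum hκr hkκ σ (σ - β) (s₀ + β - σ) hσ (by linarith) (by linarith)
  -- h : 0 ≤ σ(1 + c + Δ(k-1)) - (σ-β)(1-Δ) + Δ(s₀+β-σ) ; this is the same polynomial
  set c : ℚ := (((K ^ 2 / 4 : ℕ) : ℚ) / K - 1) with hc
  set Δ : ℚ := c - ((((K - 1) ^ 2 / 4 : ℕ) : ℚ) / ((K - 1 : ℕ) : ℚ) - 1) with hΔ
  have key : σ * (1 + c + Δ * ((k : ℚ) - 1)) - (σ - β) * (1 - Δ) + Δ * (s₀ + β - σ)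
      = β + σ * c + Δ * (s₀ + σ * ((k : ℚ) - 1)) := by ring
  linarith [key]

/-- **The easy half**: if the `C₀`-slope is non-negative, `β ≥ 0`, the (DC+) margin at the arm's end is non-negative outright
(`σ ≥ 0`, `s₀ ≥ 0` — the antithetic covariance of `{x↔c}` and `{x↔u}`, Harris —, `c K ≥ 0` and `Δ ≥ 0` for `K ≥ 5`, `k ≥ 1`).
[cite: Harris1960, Lemma 4.1 (p. 16)] -/
theorem dcplus_oneArm_margin_nonneg_of_beta_nonneg (K k : ℕ) (hK : 5 ≤ K) (hk : 1 ≤ k)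
    (β σ s₀ : ℚ) (hβ : 0 ≤ β) (hσ : 0 ≤ σ) (hs₀ : 0 ≤ s₀) :
    0 ≤ β + σ * ((((K ^ 2 / 4 : ℕ) : ℚ) / K - 1))
        + ((((K ^ 2 / 4 : ℕ) : ℚ) / K - 1) - ((((K - 1) ^ 2 / 4 : ℕ) : ℚ) / ((K - 1 : ℕ) : ℚ) - 1)) * (s₀ + σ * ((k : ℚ) - 1)) := by
  obtain ⟨hΔ0, _⟩ := sizeLawConst_delta_lt_third K hK
  have hc0 : 0 ≤ (((K ^ 2 / 4 : ℕ) : ℚ) / K - 1) := by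
    -- ⌊K²/4⌋ ≥ K for K ≥ 4
    have h4 : K ≤ K ^ 2 / 4 := by
      apply (Nat.le_div_iff_mul_le (by norm_num)).2
      nlinarith
    have hKpos : (0 : ℚ) < K := by exact_mod_cast (show 0 < K by omega)
    rw [sub_nonneg, le_div_iff₀ hKpos, one_mul]
    exact_mod_cast h4
  have hk1 : (0 : ℚ) ≤ (k : ℚ) - 1 := by
    have : (1 : ℚ) ≤ k := by exact_mod_cast hk
    linarith
  have h1 : 0 ≤ σ * ((((K ^ 2 / 4 : ℕ) : ℚ) / K - 1)) := mul_nonneg hσ hc0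
  have h2 : 0 ≤ s₀ + σ * ((k : ℚ) - 1) := by positivity
  have h3 := mul_nonneg hΔ0 h2
  linarith

end Summit.CriticalPhenomena.PercolationContinuityZ3.Theorems.CSH
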